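import Mathlib

/-!
# `Balaban1983to89.B7Prop6Bound` — the assembly (159)–(164) of B7 Proposition 6 with an EXPLICIT, uniform `O(1)`

CITATION HEADER (lean-in-tree rule 2026-08-18). Reproduction of the arithmetic of T. Bałaban, *Averaging operations
for lattice gauge theories*, Comm. Math. Phys. **98**, 17–51 (1985) [Balaban1985Averaging] (cell paper B7;
`paper:balaban1985-cmp98-averaging`, journal page = PDF page + 16), Sect. E pp. 42–43 [PDF 26–27], render-checked
2026-08-18 (`b2b-balaban-ref1/pages/1985-cmp98-averaging/…-p026-x2.png`, `…-p027-x2.png`).  The paper is UNDER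
ADJUDICATION by the audit cell `pub-balaban`; nothing of it is asserted here.

WHAT IS PRINTED.  (159) `Ū^k_b(Ū^k_{0,b})⁻¹ = v_k(b₋)(Ū′^k)_b R̄^k_{0,b} v_k⁻¹(b₊)`, (160) `v_k(x) = (R̄_{0,x}U′)(R̄_{0,x}Ū′)⋯(R̄^{k−1}_{0,x}Ū′^{k−1})`,
(161) `|(1/i) log Ū′^j| = |Q_j(U₀, ηA′)| < 2α₁L^jη` (from Prop. 4, (131)), (162) `|(1/i) log(R̄^j_{0,x}Ū′^j)| < 8α₁dL^{j+1}η e^{2α₁dL^{j+1}η}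
< O(1)α₁L^{j+1}η, j = 0, …, k−1`, (163) `|v_k(x) − 1| < O(1)α₁ Σ_{j=0}^{k−1} L^{j+1}η ≤ O(1)α₁`, and Proposition 6 (164)
`|Ū′Ū₀^k (Ū₀^k)⁻¹ − 1| < O(1)α₁`, "Of course, we assume that α₀, α₁ are sufficiently small."

WHAT THIS FILE CERTIFIES (answers the conditional clause of GAPS G-A2-1: B9 p. 406 uses (164) with an `O(1)` UNIFORM in the
number of steps `k` and LINEAR in `α₁`; the print's `O(1)` is unquantified):
* `prod_sub_one_norm_le` — in any normed ring, `‖∏ aⱼ − 1‖ ≤ ∏(1 + ‖aⱼ − 1‖) − 1 ≤ exp(Σ‖aⱼ − 1‖) − 1`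
  (telescoping); this is the step (162) ⇒ (163) for the product (160) and the step (162)–(163) ⇒ (164) for the triple
  product (159) (with `R̄^k_{0,b}` unitary, `‖R̄‖ = 1`, absorbed into the factor `(Ū′^k)_b R̄`).
* `geom_tail_le` — with `L^kη = 1` (k averaging steps from spacing `η` to the unit lattice) and `L ≥ 2`:
  `Σ_{j=0}^{k−1} L^{j+1}η = Σ_{j=0}^{k−1} L^{j+1−k} ≤ L/(L−1) ≤ 2`, uniformly in `k`.
* `ineq163_explicit` — if `‖aⱼ − 1‖ ≤ c·α₁·L^{j+1}η` for `j < k` (the shape of (162), `c = 8d e^{2α₁d}` once `L^{j+1}η ≤ 1`),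
  then `‖∏_{j<k} aⱼ − 1‖ ≤ exp(2cα₁) − 1 ≤ 2cα₁·exp(2cα₁)` — (163) with the explicit constant `O(1) = 2c·e^{2cα₁}`,
  uniform in `k` and linear in `α₁` for `α₁` in any bounded range.
NOT certified here (printed inputs): (161) (Prop. 4, (131)) and the group-theoretic step (161) ⇒ (162). [folklore]
-/

noncomputable section

namespace Literature.MathematicalPhysics.QuantumFieldTheory.Balaban1983to89.B7Prop6Bound

open Finset

variable {R : Type*} [NormedRing R]

/-- Telescoping: `‖a·b − 1‖ ≤ (1 + ‖a − 1‖)(1 + ‖b − 1‖) − 1`. [folklore] -/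
theorem mul_sub_one_norm_le (a b : R) :
    ‖a * b - 1‖ ≤ (1 + ‖a - 1‖) * (1 + ‖b - 1‖) - 1 := by
  have h : a * b - 1 = (a - 1) * (b - 1) + (a - 1) + (b - 1) := by noncomm_ring
  rw [h]
  calc ‖(a - 1) * (b - 1) + (a - 1) + (b - 1)‖
      ≤ ‖(a - 1) * (b - 1) + (a - 1)‖ + ‖b - 1‖ := norm_add_le _ _
    _ ≤ ‖(a - 1) * (b - 1)‖ + ‖a - 1‖ + ‖b - 1‖ := by
        have := norm_add_le ((a - 1) * (b - 1)) (a - 1); linarith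
    _ ≤ ‖a - 1‖ * ‖b - 1‖ + ‖a - 1‖ + ‖b - 1‖ := by
        have := norm_mul_le (a - 1) (b - 1); linarith
    _ = (1 + ‖a - 1‖) * (1 + ‖b - 1‖) - 1 := by ring

/-- Ordered (non-commutative) product `oprod a k = a 0 * a 1 * ⋯ * a (k−1)` (the product (160) of B7). [folklore] -/
def oprod (a : ℕ → R) : ℕ → R
  | 0 => 1
  | n + 1 => oprod a n * a n

/-- `‖a₀⋯a_{k−1} − 1‖ ≤ ∏_{j<k}(1 + ‖aⱼ − 1‖) − 1`. [folklore] -/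
theorem prod_sub_one_norm_le (a : ℕ → R) (k : ℕ) :
    ‖oprod a k - 1‖ ≤ (∏ j ∈ range k, (1 + ‖a j - 1‖)) - 1 := by
  induction k with
  | zero => simp [oprod]
  | succ n ih =>
    rw [prod_range_succ]
    simp only [oprod]
    have h1 := mul_sub_one_norm_le (oprod a n) (a n)
    have h2 : 0 ≤ 1 + ‖a n - 1‖ := by positivity
    calc ‖oprod a n * a n - 1‖
        ≤ (1 + ‖oprod a n - 1‖) * (1 + ‖a n - 1‖) - 1 := h1
      _ ≤ (1 + ((∏ j ∈ range n, (1 + ‖a j - 1‖)) - 1)) * (1 + ‖a n - 1‖) - 1 := by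
          have := mul_le_mul_of_nonneg_right (add_le_add_left ih 1) h2; linarith
      _ = (∏ j ∈ range n, (1 + ‖a j - 1‖)) * (1 + ‖a n - 1‖) - 1 := by ring

/-- `∏(1 + εⱼ) ≤ exp(Σ εⱼ)` for `εⱼ ≥ 0`. [folklore] -/
theorem prod_one_add_le_exp_sum (ε : ℕ → ℝ) (k : ℕ) (hε : ∀ j, 0 ≤ ε j) :
    (∏ j ∈ range k, (1 + ε j)) ≤ Real.exp (∑ j ∈ range k, ε j) := by
  rw [Real.exp_sum]
  apply Finset.prod_le_prod
  · intro j _; have := hε j; linarith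
  · intro j _; exact Real.add_one_le_exp (ε j) |>.trans_eq' (by ring)

/-- Uniform geometric tail: for `L ≥ 2` (real), `Σ_{j=0}^{k−1} L^{j+1}/L^k ≤ L/(L−1) ≤ 2`. [folklore] -/
theorem geom_tail_le (L : ℝ) (hL : 2 ≤ L) (k : ℕ) :
    (∑ j ∈ range k, L ^ (j + 1) / L ^ k) ≤ 2 := by
  have hLpos : 0 < L := by linarith
  have hL1 : L - 1 ≠ 0 := by linarith
  have hLk : 0 < L ^ k := pow_pos hLpos k
  have hsum : (∑ j ∈ range k, L ^ (j + 1) / L ^ k) = L / L ^ k * ((L ^ k - 1) / (L - 1)) := by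
    rw [← geom_sum_eq (by linarith : L ≠ 1) k, Finset.mul_sum]
    apply Finset.sum_congr rfl
    intro j _
    rw [pow_succ]; field_simp
  rw [hsum]
  have h1 : L / L ^ k * ((L ^ k - 1) / (L - 1)) ≤ L / (L - 1) := by
    rw [div_mul_div_comm, div_le_div_iff₀ (by nlinarith [hLk]) (by linarith)]
    nlinarith [hLk]
  have h2 : L / (L - 1) ≤ 2 := by
    rw [div_le_iff₀ (by linarith)]; linarith
  linarith

/-- (163) with an explicit constant: per-step bounds `‖aⱼ − 1‖ ≤ c α₁ L^{j+1}η`, `L^kη = 1` (so `L^{j+1}η = L^{j+1}/L^k`),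
`L ≥ 2`, `c, α₁ ≥ 0` ⇒ `‖a₀⋯a_{k−1} − 1‖ ≤ exp(2cα₁) − 1 ≤ 2cα₁ exp(2cα₁)`. [folklore] -/
theorem ineq163_explicit (a : ℕ → R) (k : ℕ) (L c α₁ : ℝ) (hL : 2 ≤ L) (hc : 0 ≤ c) (hα : 0 ≤ α₁)
    (hstep : ∀ j < k, ‖a j - 1‖ ≤ c * α₁ * (L ^ (j + 1) / L ^ k)) :
    ‖oprod a k - 1‖ ≤ Real.exp (2 * c * α₁) - 1 ∧
      Real.exp (2 * c * α₁) - 1 ≤ 2 * c * α₁ * Real.exp (2 * c * α₁) := by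
  have hsum : (∑ j ∈ range k, ‖a j - 1‖) ≤ 2 * c * α₁ := by
    calc (∑ j ∈ range k, ‖a j - 1‖) ≤ ∑ j ∈ range k, c * α₁ * (L ^ (j + 1) / L ^ k) :=
          Finset.sum_le_sum fun j hj => hstep j (Finset.mem_range.mp hj)
      _ = c * α₁ * ∑ j ∈ range k, L ^ (j + 1) / L ^ k := by rw [Finset.mul_sum]
      _ ≤ c * α₁ * 2 := mul_le_mul_of_nonneg_left (geom_tail_le L hL k) (by positivity)
      _ = 2 * c * α₁ := by ring
  refine ⟨?_, ?_⟩
  · calc ‖oprod a k - 1‖ ≤ (∏ j ∈ range k, (1 + ‖a j - 1‖)) - 1 := prod_sub_one_norm_le a k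
      _ ≤ Real.exp (∑ j ∈ range k, ‖a j - 1‖) - 1 := by
          have := prod_one_add_le_exp_sum (fun j => ‖a j - 1‖) k (fun j => norm_nonneg _); linarith
      _ ≤ Real.exp (2 * c * α₁) - 1 := by
          have := Real.exp_le_exp.mpr hsum; linarith
  · -- e^x − 1 ≤ x e^x for x ≥ 0
    have hx : 0 ≤ 2 * c * α₁ := by positivity
    have h1 : Real.exp (-(2 * c * α₁)) ≥ 1 - 2 * c * α₁ := by
      have := Real.add_one_le_exp (-(2 * c * α₁)); linarith
    have hpos : 0 < Real.exp (2 * c * α₁) := Real.exp_pos _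
    have hinv : Real.exp (-(2 * c * α₁)) = (Real.exp (2 * c * α₁))⁻¹ := Real.exp_neg _
    rw [hinv] at h1
    have := mul_le_mul_of_nonneg_left h1 hpos.le
    rw [mul_inv_cancel₀ hpos.ne'] at this
    nlinarith

end Literature.MathematicalPhysics.QuantumFieldTheory.Balaban1983to89.B7Prop6Bound
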